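import Summits.CriticalPhenomena.PercolationContinuityZ3.Theorems.PercNearOneGluingNoHeavyPcintKernNFZ4S8Defs
import Summits.CriticalPhenomena.PercolationContinuityZ3.Theorems.PercNearOneGluingNoHeavyPcintWinKernelTree
import HarnessLib

/-!
# PCINT lane, kernel check 1/30 of the B2r window certificate `d = 4`, memory 8 (7-step windows; 9696 first-use normal forms of 2097152 codes): normal-form codes in `[0, 37520)`

Cell `prim-pcint`, seat `prim-pcint-2` (gen 2).  Collatz–Wielandt rows `10^5 · row ≤ 99999 · DEN · v` on the 324 normal-form codes in
`[0, 37520)` (`WinK.nfCodesIn`), by `decide +kernel` in blocks of at most `48` rows (`WinK.allB`, natural-number arithmetic only;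
`maxHeartbeats 0`) — table values read from the search tree `WinK.KT.ofListF 12 tbl` (`…PcintWinKernelTree`).  Does NOT build on p205010.
-/

namespace Summit.CriticalPhenomena.PercolationContinuityZ3.Theorems.Pcint.NFZ4S8

set_option maxHeartbeats 0 in
/-- The 48 rows with normal-form code in `[0, 3344)` hold. [folklore] -/
theorem chk_0_3344 : (WinK.nfCodesIn 4 7 0 3344).all (WinK.rowOKST 4 6 1677 9742 99999 (WinK.KT.ofListF 12 tbl) 51200) = true :=
  WinK.all_of_allB (fuel := 20) (by decide +kernel)

set_option maxHeartbeats 0 in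
/-- The 48 rows with normal-form code in `[3344, 6928)` hold. [folklore] -/
theorem chk_3344_6928 : (WinK.nfCodesIn 4 7 3344 6928).all (WinK.rowOKST 4 6 1677 9742 99999 (WinK.KT.ofListF 12 tbl) 51200) = true :=
  WinK.all_of_allB (fuel := 20) (by decide +kernel)

set_option maxHeartbeats 0 in
/-- The 48 rows with normal-form code in `[6928, 10512)` hold. [folklore] -/
theorem chk_6928_10512 : (WinK.nfCodesIn 4 7 6928 10512).all (WinK.rowOKST 4 6 1677 9742 99999 (WinK.KT.ofListF 12 tbl) 51200) = true :=
  WinK.all_of_allB (fuel := 20) (by decide +kernel)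

set_option maxHeartbeats 0 in
/-- The 48 rows with normal-form code in `[10512, 16528)` hold. [folklore] -/
theorem chk_10512_16528 : (WinK.nfCodesIn 4 7 10512 16528).all (WinK.rowOKST 4 6 1677 9742 99999 (WinK.KT.ofListF 12 tbl) 51200) = true :=
  WinK.all_of_allB (fuel := 20) (by decide +kernel)

set_option maxHeartbeats 0 in
/-- The 48 rows with normal-form code in `[16528, 23312)` hold. [folklore] -/
theorem chk_16528_23312 : (WinK.nfCodesIn 4 7 16528 23312).all (WinK.rowOKST 4 6 1677 9742 99999 (WinK.KT.ofListF 12 tbl) 51200) = true :=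
  WinK.all_of_allB (fuel := 20) (by decide +kernel)

set_option maxHeartbeats 0 in
/-- The 48 rows with normal-form code in `[23312, 34064)` hold. [folklore] -/
theorem chk_23312_34064 : (WinK.nfCodesIn 4 7 23312 34064).all (WinK.rowOKST 4 6 1677 9742 99999 (WinK.KT.ofListF 12 tbl) 51200) = true :=
  WinK.all_of_allB (fuel := 20) (by decide +kernel)

set_option maxHeartbeats 0 in
/-- The 36 rows with normal-form code in `[34064, 37520)` hold. [folklore] -/
theorem chk_34064_37520 : (WinK.nfCodesIn 4 7 34064 37520).all (WinK.rowOKST 4 6 1677 9742 99999 (WinK.KT.ofListF 12 tbl) 51200) = true :=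
  WinK.all_of_allB (fuel := 20) (by decide +kernel)

/-- The rows with normal-form code in `[0, 37520)` hold. [folklore] -/
theorem chkFile_1 : (WinK.nfCodesIn 4 7 0 37520).all (WinK.rowOKST 4 6 1677 9742 99999 (WinK.KT.ofListF 12 tbl) 51200) = true :=
  WinK.all_nfCodesIn_append (WinK.all_nfCodesIn_append (WinK.all_nfCodesIn_append (WinK.all_nfCodesIn_append (WinK.all_nfCodesIn_append (WinK.all_nfCodesIn_append chk_0_3344 chk_3344_6928) chk_6928_10512) chk_10512_16528) chk_16528_23312) chk_23312_34064) chk_34064_37520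

end Summit.CriticalPhenomena.PercolationContinuityZ3.Theorems.Pcint.NFZ4S8
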